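import Summits.Ventures.YMGap.RobustBall.ZNGaugeLayer
import HarnessLib

/-!
# RobustBall/ZNFluxLayer — the `i`-link layer of a `ℤ_N` lattice gauge theory with ARBITRARY inhomogeneous
# plaquette-flux weights `exp(∑_p G_p(flux_p))`: Dobrushin influences `≤ A` per shared plaquette, row sums
# `≤ 2(d−1)A`, layer `ℤ_N` symmetry, and the two-point bound `‖E ψ(k_b − k_t)‖ ≤ 4 c^{dist_j(b,t)}`

HONEST FRAMING: venture file of the cell `pub-ymgap` (QuantumFields programme), track Y2 ROBUST-BALL, seat ds-4
g8.  Finite sums on a finite torus; no `SU(N)` measure here, no area law yet (that is `ZNFluxPeeling` /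
`CentreTubeAreaLaw`); nothing about the continuum limit or a Clay-sense mass gap.

WHAT THIS IS: gen 7's `ZNGaugeLayer` (weights `exp(β ∑_p Re(ψ(flux_p)·a_p))`, the Wilson-type `ℤ_N` action) made a
functor in the plaquette weight.  Setting: direction `i`, transverse values `kT` FROZEN, an ARBITRARY family of
real flux weights `G : Plaquette → ℤ/N → ℝ` with `|G p s| ≤ A` (non-Wilson, inhomogeneous `ℤ_N` plaquette actions:
for the centre-tube area law `G p s = β Re(ψ(s) tr U_p) − g_p(s, U)`, the Wilson part plus the twist defect of a
flux-local perturbation); the `i`-link system is the finite spin system `kI : Site d L → ℤ/N` with weight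
`layerWeightG = exp(∑_p G_p(flux_p(glue kI kT)))`.
* influences (`tv_layerWeightG_le`): `tv ≤ A · #{p reading both sites}` = gen 7's `ZN.layerC i 1 A`
  (`FiniteGibbs.tv_le_of_exp_sum` at `β = 1`); row sums `≤ 2(d−1)A` (`rowsum_layerC_one_le`);
* symmetry (`cavg_ψ_eval_eq_zero`): shifting every `i`-link by `1` preserves EVERY flux (`plaqSum_glue_add_const`),
  hence the weight, so one-point functions `E ψ(k_b)` vanish for `N ≥ 2` — for any `G`;
* **`norm_cavg_ψ_sub_le`**: for `c = 2(d−1)A ≤ 1`, `‖E ψ(k_b − k_t)‖ ≤ 4 · c^{jDist j t b}`.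
References for the mechanism: Mack–Petkova 1979 §2; Durhuus–Fröhlich 1980 (layer expansion); Georgii 2011
Prop. 8.8 (Dobrushin coefficients).
-/

noncomputable section

open Finset Function
open Literature.MathematicalPhysics.QuantumFieldTheory

namespace Summit.Ventures.YMGap.RobustBall

namespace ZNFlux

open ZN

variable {d L N : ℕ} [NeZero L] [NeZero N]

/-! ### The layer weight with arbitrary flux weights -/

/-- The plaquette term of the `i`-link system: `G_p(flux_p(glue kI kT))`. [folklore] -/
def phiG (i : Fin d) (kT : Transverse d L (ZMod N) i) (G : Plaquette d L → ZMod N → ℝ) (p : Plaquette d L)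
    (kI : Site d L → ZMod N) : ℝ :=
  G p (plaqSum (glue i kI kT) p.1 p.2.1.1 p.2.1.2)

/-- The weight of the `i`-link system given the transverse links: `exp(∑_p G_p(flux_p))`. [folklore] -/
def layerWeightG (i : Fin d) (kT : Transverse d L (ZMod N) i) (G : Plaquette d L → ZMod N → ℝ)
    (kI : Site d L → ZMod N) : ℝ :=
  Real.exp (∑ p, phiG i kT G p kI)

omit [NeZero N] in
/-- The layer weight is positive. [folklore] -/
theorem layerWeightG_pos (i : Fin d) (kT : Transverse d L (ZMod N) i) (G : Plaquette d L → ZMod N → ℝ)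
    (kI : Site d L → ZMod N) : 0 < layerWeightG i kT G kI := Real.exp_pos _

omit [NeZero N] in
/-- The layer weight in the `exp(β ∑ φ)` normal form with `β = 1`. [folklore] -/
theorem layerWeightG_eq_exp_one_mul (i : Fin d) (kT : Transverse d L (ZMod N) i) (G : Plaquette d L → ZMod N → ℝ)
    (kI : Site d L → ZMod N) : layerWeightG i kT G kI = Real.exp (1 * ∑ p, phiG i kT G p kI) := by
  rw [one_mul]; rfl

omit [NeZero L] in
/-- The plaquette term reads `kI` only on `iSites i p`. [folklore] -/
theorem dependsOn_phiG (i : Fin d) (kT : Transverse d L (ZMod N) i) (G : Plaquette d L → ZMod N → ℝ)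
    (p : Plaquette d L) : DependsOn (phiG i kT G p) (↑(iSites i p) : Set (Site d L)) := fun kI kI' h => by
  unfold phiG
  rw [plaqSum_glue_congr i kT p fun y hy => h y (Finset.mem_coe.2 hy)]

omit [NeZero L] [NeZero N] in
/-- `|phiG| ≤ A` when `|G p s| ≤ A`. [folklore] -/
theorem abs_phiG_le (i : Fin d) (kT : Transverse d L (ZMod N) i) {G : Plaquette d L → ZMod N → ℝ} {A : ℝ}
    (hA : ∀ p s, |G p s| ≤ A) (p : Plaquette d L) (kI : Site d L → ZMod N) : |phiG i kT G p kI| ≤ A :=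
  hA p _

/-! ### Dobrushin influences of the layer system (coefficients = gen 7's `ZN.layerC i 1 A`) -/

/-- **One-site influences of the layer system**: `tv ≤ ZN.layerC i 1 A` for environments differing at one other
site (any flux weights with `|G| ≤ A`). [folklore] -/
theorem tv_layerWeightG_le (i : Fin d) (kT : Transverse d L (ZMod N) i) {G : Plaquette d L → ZMod N → ℝ} {A : ℝ}
    (hA : ∀ p s, |G p s| ≤ A) (y y' : Site d L) (hy : y' ≠ y) (σ τ : Site d L → ZMod N)
    (hστ : ∀ z, z ≠ y' → σ z = τ z) :
    FiniteGibbs.tv (layerWeightG i kT G) y σ τ ≤ ZN.layerC i 1 A y y' := by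
  classical
  rw [ZN.layerC, if_neg hy]
  exact FiniteGibbs.tv_le_of_exp_sum (iSites i) (phiG i kT G) (dependsOn_phiG i kT G) (abs_phiG_le i kT hA) 1
    (layerWeightG_eq_exp_one_mul i kT G) hστ

/-- **Row sums of the layer influences**: `∑_{y'} layerC i 1 A y y' ≤ 2(d−1) A`. [folklore] -/
theorem rowsum_layerC_one_le (i : Fin d) {A : ℝ} (hA : 0 ≤ A) (y : Site d L) :
    ∑ y' ∈ ZN.layerNbr i y, ZN.layerC i 1 A y y' ≤ 2 * ((d - 1 : ℕ) : ℝ) * A := by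
  have h := ZN.rowsum_layerC_le (L := L) i 1 hA y
  rwa [abs_one, mul_one] at h

/-! ### Layer `ℤ_N` symmetry: one-point functions vanish (for every `G`) -/

/-- Shifting every `i`-link by a constant preserves every flux, hence the layer weight. [folklore] -/
theorem layerWeightG_add_const (i : Fin d) (kT : Transverse d L (ZMod N) i) (G : Plaquette d L → ZMod N → ℝ)
    (kI : Site d L → ZMod N) (c : ZMod N) :
    layerWeightG i kT G (kI + fun _ => c) = layerWeightG i kT G kI := by
  rw [show (kI + fun _ => c) = fun y => kI y + c from rfl]
  unfold layerWeightG phiG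
  simp only [plaqSum_glue_add_const]

/-- **One-point functions of the layer system vanish** (`N ≥ 2`): `E ψ(k_b) = 0`. [folklore] -/
theorem cavg_ψ_eval_eq_zero (hN : 2 ≤ N) (i : Fin d) (kT : Transverse d L (ZMod N) i)
    (G : Plaquette d L → ZMod N → ℝ) (b : Site d L) :
    FiniteGibbs.cavg (layerWeightG i kT G) (fun kI => ψ N (kI b)) = 0 := by
  set w := layerWeightG i kT G with hw
  have hsum : ∑ kI : Site d L → ZMod N, (w kI : ℂ) * ψ N (kI b) =
      ψ N 1 * ∑ kI : Site d L → ZMod N, (w kI : ℂ) * ψ N (kI b) := by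
    have hre : ∑ kI : Site d L → ZMod N, (w kI : ℂ) * ψ N (kI b) =
        ∑ kI : Site d L → ZMod N, (w (kI + fun _ => (1 : ZMod N)) : ℂ) * ψ N (kI b + 1) := by
      refine (Fintype.sum_equiv (Equiv.addRight (fun _ : Site d L => (1 : ZMod N))) _ _ fun kI => ?_).symm
      simp only [Equiv.coe_addRight, Pi.add_apply]
    conv_lhs => rw [hre]
    rw [Finset.mul_sum]
    refine Finset.sum_congr rfl fun kI _ => ?_
    rw [hw, layerWeightG_add_const, ψ_add]
    ring
  have hz : (1 - ψ N 1) * ∑ kI : Site d L → ZMod N, (w kI : ℂ) * ψ N (kI b) = 0 := by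
    rw [sub_mul, one_mul, ← hsum, sub_self]
  rcases mul_eq_zero.1 hz with h | h
  · exact absurd (sub_eq_zero.1 h).symm (ψ_one_ne_one hN)
  · rw [FiniteGibbs.cavg, h, zero_div]

/-! ### The two-point bound -/

/-- **Two-point functions of the layer system** (`N ≥ 2`, `c = 2(d−1)A ≤ 1`, any flux weights `|G| ≤ A`): for
`i`-sites `b, t`, `‖E ψ(k_b − k_t)‖ ≤ 4 · c^{jDist j t b}` — condition on `k_t` (Dobrushin comparison in the
`j`-distance profile, oscillation `2` for `Re ψ`, `Im ψ`) and use `E ψ(k_b) = 0`. [folklore] -/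
theorem norm_cavg_ψ_sub_le (hN : 2 ≤ N) (i j : Fin d) (kT : Transverse d L (ZMod N) i)
    {G : Plaquette d L → ZMod N → ℝ} {A : ℝ} (hA0 : 0 ≤ A) (hA : ∀ p s, |G p s| ≤ A) {c : ℝ}
    (hc : 2 * ((d - 1 : ℕ) : ℝ) * A ≤ c) (hc1 : c ≤ 1) (b t : Site d L) :
    ‖FiniteGibbs.cavg (layerWeightG i kT G) (fun kI => ψ N (kI b - kI t))‖ ≤ 4 * c ^ jDist j t b := by
  classical
  set w := layerWeightG i kT G with hw
  have hwpos : ∀ kI, 0 < w kI := layerWeightG_pos i kT G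
  have hc0 : 0 ≤ c := le_trans (by positivity) hc
  -- Dobrushin comparison for the real observables `Re ψ(k_b)`, `Im ψ(k_b)`
  have hcomp : ∀ (φ : ZMod N → ℝ), (∀ s s', |φ s - φ s'| ≤ 2) → ∀ s₀ : ZMod N,
      |FiniteGibbs.avg w (fun kI => φ (kI b)) - FiniteGibbs.avg (FiniteGibbs.fiber w t s₀) (fun kI => φ (kI b))| ≤
        c ^ jDist j t b * 2 := by
    intro φ hφ s₀
    exact FiniteGibbs.abs_avg_sub_avg_fiber_le hwpos (C := ZN.layerC i 1 A) (nbr := ZN.layerNbr i)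
      (fun y y' => ZN.layerC_nonneg i 1 hA0 y y') (fun y y' h => ZN.layerC_eq_zero i 1 A y y' h)
      (fun y y' hy σ τ hστ => tv_layerWeightG_le i kT hA y y' hy σ τ hστ) hc0 hc1
      (fun y => (rowsum_layerC_one_le i hA0 y).trans hc) t (jDist j t) (jDist_self j t)
      (fun y _ y' hy' => ZN.jDist_le_of_mem_layerNbr i j t y hy') s₀ b φ hφ
  have hosc_re : ∀ s s' : ZMod N, |(ψ N s).re - (ψ N s').re| ≤ 2 := fun s s' => by
    rw [← Complex.sub_re]
    refine (Complex.abs_re_le_norm _).trans ((norm_sub_le _ _).trans ?_)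
    rw [norm_ψ, norm_ψ]; norm_num
  have hosc_im : ∀ s s' : ZMod N, |(ψ N s).im - (ψ N s').im| ≤ 2 := fun s s' => by
    rw [← Complex.sub_im]
    refine (Complex.abs_im_le_norm _).trans ((norm_sub_le _ _).trans ?_)
    rw [norm_ψ, norm_ψ]; norm_num
  -- the conditioned averages of `ψ(k_b)` are within `4 c^ℓ` of the unconditioned one
  have hB : ∀ s₀ : ZMod N, 0 < FiniteGibbs.mass (FiniteGibbs.fiber w t s₀) →
      ‖FiniteGibbs.cavg (FiniteGibbs.fiber w t s₀) (fun kI => ψ N (kI b)) -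
        FiniteGibbs.cavg w (fun kI => ψ N (kI b))‖ ≤ 4 * c ^ jDist j t b := by
    intro s₀ _
    refine (FiniteGibbs.norm_cavg_sub_cavg_le _ _ _).trans ?_
    have h1 := hcomp (fun s => (ψ N s).re) hosc_re s₀
    have h2 := hcomp (fun s => (ψ N s).im) hosc_im s₀
    rw [abs_sub_comm] at h1 h2
    linarith
  -- conditioning on `k_t`
  have hmain := FiniteGibbs.norm_cavg_mul_sub_le (fun kI => (hwpos kI).le) (FiniteGibbs.mass_pos_of_pos hwpos) t
    (fun kI => ψ N (kI b)) (fun s => ψ N (-s)) (MG := 1) (fun s => (norm_ψ _).le) hB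
  rw [cavg_ψ_eval_eq_zero hN, zero_mul, sub_zero, one_mul] at hmain
  have heq : (fun kI : Site d L → ZMod N => ψ N (kI b) * ψ N (-kI t)) = fun kI => ψ N (kI b - kI t) := by
    funext kI; rw [← ψ_add, sub_eq_add_neg]
  rw [heq] at hmain
  exact hmain

end ZNFlux

end Summit.Ventures.YMGap.RobustBall

end
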